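import Literature.AlgebraicGeometry.Motives.HirschowitzIyerCoveringAlgebra
import Mathlib.RingTheory.Valuation.LocalSubring
import Mathlib.RingTheory.Localization.AtPrime.Basic
import Mathlib.RingTheory.LocalRing.ResidueField.Basic
import HarnessLib

/-!
# Strong lines cover a `(2,3)` complete intersection in `ℙ⁸`: the valuative half

Hirschowitz–Iyer [HirschowitzIyer2010], §6 Prop. 6.1 (spannedness) at `(n, r, s, d) = (8, 1, 2, (2, 3))`:
**through every point `x` of `Y = V₊(Q, C) ⊂ ℙ⁸` (any quadric `Q` and cubic `C`, over an algebraically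
closed field of characteristic zero) passes a strong line** — a line `ℓ ∋ x` with a `2`-plane
`Π ⊇ ℓ` such that `Q|_Π = 0` and `C|_Π ∈ k · m³`, `m` the equation of `ℓ` in `Π` (a `3`-fat line of
`Y`, HI Prop. 2.3). This file finishes the coordinate proof begun in
`Motives/HirschowitzIyerCoveringAlgebra`, whose `ker_phiStar_eq` says that the universal strong-line
family `Φ : 𝔸⁸¹⁶ → N` is DOMINANT onto the incidence `𝕋 = {Q_B(x) = C_T(x) = 0}`. HI conclude by
properness of the flag-Hilbert scheme over `ℋ₂'` ("its image is also projective over `ℋ₂`. So it is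
sufficient to prove that `e'` is dominant", §6); here properness enters in its valuative form, in
coordinates, with no schemes at all:

* `IsFatFlag B T u v w` (§1): `Q_B ≡ 0` on `span(u, v, w)` and `C_T(c₀u + c₁v + c₂w) = c₂³ C_T(w)`,
  pointwise in the coefficients; `isFatFlag_universal`: the tautological flag `(x, a, y)` of `Φ` is fat
  in every `k[𝔸⁸¹⁶]`-algebra (from `Bmat_eq`/`Tp_eq` of the algebra file: `bilin_phiB_comb`,
  `trilin_phiT_comb`).
* §2: fat flags are preserved by surjections (`IsFatFlag.map`), detected after injections
  (`IsFatFlag.of_injective`) and invariant under change of basis of the flag (`IsFatFlag.baseChange`).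
* §3 `exists_integral_fatFlag` — **the Plücker pivot**: over the fraction field `L` of a valuation
  ring `𝒪`, a fat flag in unitriangular normal form with `x ∈ 𝒪⁹` has a fat flag of the same line and
  plane with ALL vectors in `𝒪⁹`, in chart normal form (`u_{i₀} = v_{j₀} = w_{c₀} = 1`,
  `u_{j₀} = v_{i₀} = w_{i₀} = w_{j₀} = 0`) and with `x = x_{i₀} u + x_{j₀} v`: divide the rows of
  `x ∧ a` through the entry of least valuation (`exists_forall_div_mem`), reduce `y` modulo the line
  and divide by its entry of least valuation — the valuative criterion of properness for the variety
  of flags `ℓ ⊂ Π`, in coordinates.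
* §4 `exists_fatFlag_of_incidence` — **the covering theorem in coordinates**: for `t = (B, T, x')`
  with `Q_B(x) = C_T(x) = 0`, `x = (1, x')`, there are `u, v, w ∈ K⁹`, linearly independent, with
  `x ∈ span(u, v)` and `IsFatFlag B T u v w`. Proof: `𝔪_t ⊇ ker Φ*` (`ker_phiStar_eq`), so
  `Φ* : k[N] → k[𝔸⁸¹⁶] ⊂ L = Frac k[𝔸⁸¹⁶]` extends to the local ring `k[N]_{𝔪_t}`, which is
  dominated by a valuation ring `𝒪 ⊂ L` (Mathlib `IsLocalRing.exists_factor_valuationRing`); the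
  coordinates `(B, T, x)` of the generic point lie in `𝒪` and reduce to `t` in the residue field `k_𝒪`;
  the universal fat flag, pivoted into `𝒪⁹` and reduced, is a fat flag of `(B_t, T_t)` through `x_t`
  over `k_𝒪 ⊇ K`; the normal-form equations, the incidence `x_t = x_{i₀}u + x_{j₀}v` and the (infinitely
  many) fatness equations form a polynomial system over `K` with a solution in `k_𝒪`, hence in `K`
  (`exists_eval_eq_zero_of_algHom`, weak Nullstellensatz), and the normal form makes `u, v, w`
  independent (`linearIndependent_of_normalForm`).

The translation to forms `Q, C ∈ K[x₀, …, x₈]`, to points with `x₀ = 0` (permute coordinates) and to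
the tree's `IsStrongLinePoint` (`Motives/HirschowitzIyerSurjectivity`) is the sequel.

## References

* A. Hirschowitz, J. N. N. Iyer, *Hilbert schemes of fat r-planes and the triviality of Chow groups
  of complete intersections*, Contemp. Math. 522 (2010), doi:10.1090/conm/522/10291,
  arXiv:0903.5018: §1.2, §2 Prop. 2.3, §4 Prop. 4.1, §6 Prop. 6.1–6.2. [HirschowitzIyer2010]
* The Stacks project, Tag 00IA (local rings are dominated by valuation rings). [StacksProject]
-/

noncomputable section

open MvPolynomial Matrix

namespace Literature.AlgebraicGeometry.Motives

namespace StrongLineCover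

/-! ### §1: the universal fat flag -/

section UniversalFatFlag

variable {k : Type*} [CommRing k] {S : Type*} [CommRing S] (φ : RZ k →+* S)

/-- The coefficient vector `(c₀, c₁, c₂, 0, …, 0) ∈ R⁹`. [folklore] -/
def cvec {R : Type*} [Zero R] (c : Fin 3 → R) : Fin 9 → R := ![c 0, c 1, c 2, 0, 0, 0, 0, 0, 0]

/-- A bilinear form as a double sum: `B(w, w') = Σ B_{ij} w_i w'_j`. [folklore] -/
def bilin {R : Type*} [CommRing R] (B : Fin 9 → Fin 9 → R) (w w' : Fin 9 → R) : R :=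
  ∑ i : Fin 9, ∑ j : Fin 9, B i j * w i * w' j

/-- A cubic form from a trilinear tensor: `C_T(w) = Σ T_{cde} w_c w_d w_e`. [folklore] -/
def trilin {R : Type*} [CommRing R] (T : Fin 9 × Fin 9 × Fin 9 → R) (w : Fin 9 → R) : R :=
  ∑ p : Fin 9 × Fin 9 × Fin 9, T p * w p.1 * w p.2.1 * w p.2.2

/-- The point `c₀ u + c₁ v + c₂ y` of the plane of a flag. [folklore] -/
def comb {R : Type*} [CommRing R] (u v y : Fin 9 → R) (c : Fin 3 → R) : Fin 9 → R :=
  c 0 • u + c 1 • v + c 2 • y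

/-- **Fat flags.** For forms `(B, T)` and vectors `u, v, y`: `Q_B` vanishes identically on
`span(u, v, y)` and `C_T(c₀u + c₁v + c₂y) = c₂³ C_T(y)`, i.e. `C_T|_{span(u,v,y)} ∈ R · m³` for the
linear form `m` cutting out `span(u, v)` — the line `span(u, v)` is a `3`-fat line of
`V(Q_B, C_T)` inside the plane `span(u, v, y) ⊆ V(Q_B)` (Hirschowitz–Iyer §1.2, §2 Prop. 2.3: strong
planes are supports of fat planes). Stated pointwise (for all coefficient vectors), which over an
infinite field is the polynomial identity. [cite: HirschowitzIyer2010, §1.2 and §2 Prop. 2.3] -/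
def IsFatFlag {R : Type*} [CommRing R] (B : Fin 9 → Fin 9 → R) (T : Fin 9 × Fin 9 × Fin 9 → R)
    (u v y : Fin 9 → R) : Prop :=
  (∀ c : Fin 3 → R, bilin B (comb u v y c) (comb u v y c) = 0) ∧
    ∀ c : Fin 3 → R, trilin T (comb u v y c) = c 2 ^ 3 * trilin T y

/-- A sum against `cvec c` has three terms. [folklore] -/
theorem sum_mul_cvec {R : Type*} [CommRing R] (G : Fin 9 → R) (c : Fin 3 → R) :
    ∑ i : Fin 9, G i * cvec c i = G 0 * c 0 + G 1 * c 1 + G 2 * c 2 := by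
  simp [cvec, Fin.sum_univ_succ, add_assoc]

/-- `bilin` as `w ⬝ (B w')`. [folklore] -/
theorem bilin_eq_dotProduct {R : Type*} [CommRing R] (B : Fin 9 → Fin 9 → R) (w w' : Fin 9 → R) :
    bilin B w w' = w ⬝ᵥ (Matrix.of B *ᵥ w') := by
  simp only [bilin, dotProduct, Matrix.mulVec, Matrix.of_apply, Finset.mul_sum]
  refine Finset.sum_congr rfl fun i _ => Finset.sum_congr rfl fun j _ => ?_
  ring

/-- In any `k[𝔸⁸¹⁶]`-algebra: `g (c₀, c₁, c₂, 0, …) = c₀ x + c₁ a + c₂ y`. [folklore] -/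
theorem map_g_mulVec_cvec (c : Fin 3 → S) : (g (k := k)).map φ *ᵥ cvec c = comb (φ ∘ xv) (φ ∘ av) (φ ∘ yv) c := by
  ext r
  simp only [comb, Matrix.mulVec, dotProduct, Matrix.map_apply, g, Matrix.of_apply, cvec, Pi.add_apply,
    Pi.smul_apply, smul_eq_mul, Function.comp_apply]
  simp [Fin.sum_univ_succ, frame]
  ring

/-- In any `k[𝔸⁸¹⁶]`-algebra: `g⁻¹ (c₀ x + c₁ a + c₂ y) = (c₀, c₁, c₂, 0, …)`. [folklore] -/
theorem map_ginv_mulVec_comb (c : Fin 3 → S) :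
    (ginv (k := k)).map φ *ᵥ comb (φ ∘ xv) (φ ∘ av) (φ ∘ yv) c = cvec c := by
  have h1 : (ginv (k := k)).map φ * (g (k := k)).map φ = 1 := by
    rw [← Matrix.map_mul, ginv_mul_g, Matrix.map_one _ (map_zero φ) (map_one φ)]
  rw [← map_g_mulVec_cvec, Matrix.mulVec_mulVec, h1, Matrix.one_mulVec]

/-- **`Q_{Φ*B}` vanishes on the universal plane** `span(x, a, y)`, in every `k[𝔸⁸¹⁶]`-algebra:
`(c₀x + c₁a + c₂y) ⬝ Φ*B (c₀x + c₁a + c₂y) = c ⬝ B' c = 0`. [folklore] -/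
theorem bilin_phiB_comb (c : Fin 3 → S) :
    bilin (fun i j => φ (phiBmat (k := k) i j)) (comb (φ ∘ xv) (φ ∘ av) (φ ∘ yv) c)
      (comb (φ ∘ xv) (φ ∘ av) (φ ∘ yv) c) = 0 := by
  rw [bilin_eq_dotProduct]
  have hof : (Matrix.of fun i j => φ (phiBmat (k := k) i j)) = (phiBmat (k := k)).map φ := rfl
  rw [hof, phiBmat, Matrix.map_mul, Matrix.map_mul, Matrix.transpose_map, ← Matrix.mulVec_mulVec,
    ← Matrix.mulVec_mulVec, Matrix.dotProduct_mulVec, Matrix.vecMul_transpose, map_ginv_mulVec_comb]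
  simp only [dotProduct, Matrix.mulVec, Matrix.map_apply]
  simp [Fin.sum_univ_succ, cvec, Bmat, Bp, depB, bX]
  ring

/-- **`C_{Φ*T}` on the universal plane**, in every `k[𝔸⁸¹⁶]`-algebra:
`C_{Φ*T}(c₀x + c₁a + c₂y) = c₂³ T'₂₂₂`. [folklore] -/
theorem trilin_phiT_comb (c : Fin 3 → S) :
    trilin (fun p => φ (phiT (k := k) p)) (comb (φ ∘ xv) (φ ∘ av) (φ ∘ yv) c) = c 2 ^ 3 * φ (Tp (2, 2, 2)) := by
  have hphiT : ∀ p, φ (phiT (k := k) p) = ∑ q : Fin 9 × Fin 9 × Fin 9,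
      φ (Tp q) * (ginv (k := k)).map φ q.1 p.1 * (ginv (k := k)).map φ q.2.1 p.2.1 *
        (ginv (k := k)).map φ q.2.2 p.2.2 := by
    intro p
    simp [phiT, map_sum, map_mul, Matrix.map_apply]
  simp only [trilin]
  simp_rw [hphiT]
  rw [sum_trilin_transform, map_ginv_mulVec_comb]
  rw [Fintype.sum_prod_type]
  simp_rw [Fintype.sum_prod_type]
  -- reduce the three sums to `{0, 1, 2}`
  have h3 : ∀ (a b : Fin 9), ∑ e : Fin 9, φ (Tp (k := k) (a, b, e)) * cvec c a * cvec c b * cvec c e =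
      (φ (Tp (a, b, 0)) * c 0 + φ (Tp (a, b, 1)) * c 1 + φ (Tp (a, b, 2)) * c 2) * cvec c a * cvec c b := by
    intro a b
    have := sum_mul_cvec (fun e => φ (Tp (k := k) (a, b, e)) * cvec c a * cvec c b) c
    rw [show (∑ e : Fin 9, φ (Tp (k := k) (a, b, e)) * cvec c a * cvec c b * cvec c e) =
      ∑ e : Fin 9, (φ (Tp (k := k) (a, b, e)) * cvec c a * cvec c b) * cvec c e from rfl, this]
    ring
  simp_rw [h3]
  have h2 : ∀ a : Fin 9, ∑ b : Fin 9, (φ (Tp (k := k) (a, b, 0)) * c 0 + φ (Tp (a, b, 1)) * c 1 +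
      φ (Tp (a, b, 2)) * c 2) * cvec c a * cvec c b =
      ((φ (Tp (a, 0, 0)) * c 0 + φ (Tp (a, 0, 1)) * c 1 + φ (Tp (a, 0, 2)) * c 2) * c 0 +
        (φ (Tp (a, 1, 0)) * c 0 + φ (Tp (a, 1, 1)) * c 1 + φ (Tp (a, 1, 2)) * c 2) * c 1 +
        (φ (Tp (a, 2, 0)) * c 0 + φ (Tp (a, 2, 1)) * c 1 + φ (Tp (a, 2, 2)) * c 2) * c 2) * cvec c a := by
    intro a
    have := sum_mul_cvec (fun b => (φ (Tp (k := k) (a, b, 0)) * c 0 + φ (Tp (a, b, 1)) * c 1 +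
      φ (Tp (a, b, 2)) * c 2) * cvec c a) c
    rw [show (∑ b : Fin 9, (φ (Tp (k := k) (a, b, 0)) * c 0 + φ (Tp (a, b, 1)) * c 1 +
        φ (Tp (a, b, 2)) * c 2) * cvec c a * cvec c b) =
      ∑ b : Fin 9, ((φ (Tp (k := k) (a, b, 0)) * c 0 + φ (Tp (a, b, 1)) * c 1 +
        φ (Tp (a, b, 2)) * c 2) * cvec c a) * cvec c b from rfl, this]
    ring
  simp_rw [h2]
  rw [show (∑ a : Fin 9, ((φ (Tp (k := k) (a, 0, 0)) * c 0 + φ (Tp (a, 0, 1)) * c 1 + φ (Tp (a, 0, 2)) * c 2) * c 0 +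
        (φ (Tp (a, 1, 0)) * c 0 + φ (Tp (a, 1, 1)) * c 1 + φ (Tp (a, 1, 2)) * c 2) * c 1 +
        (φ (Tp (a, 2, 0)) * c 0 + φ (Tp (a, 2, 1)) * c 1 + φ (Tp (a, 2, 2)) * c 2) * c 2) * cvec c a) =
      ∑ a : Fin 9, ((φ (Tp (k := k) (a, 0, 0)) * c 0 + φ (Tp (a, 0, 1)) * c 1 + φ (Tp (a, 0, 2)) * c 2) * c 0 +
        (φ (Tp (a, 1, 0)) * c 0 + φ (Tp (a, 1, 1)) * c 1 + φ (Tp (a, 1, 2)) * c 2) * c 1 +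
        (φ (Tp (a, 2, 0)) * c 0 + φ (Tp (a, 2, 1)) * c 1 + φ (Tp (a, 2, 2)) * c 2) * c 2) * cvec c a from rfl,
    sum_mul_cvec]
  simp [Tp, depT, depTval, tX]
  ring

/-- **The universal flag is fat in every `k[𝔸⁸¹⁶]`-algebra**: `(x, a, y)` is a fat flag of
`(Φ*B, Φ*T)`. [cite: HirschowitzIyer2010, §4 proof of Prop. 4.1 (the tautological flag ℒ ⊂ ℒ')] -/
theorem isFatFlag_universal :
    IsFatFlag (fun i j => φ (phiBmat (k := k) i j)) (fun p => φ (phiT p)) (φ ∘ xv) (φ ∘ av) (φ ∘ yv) := by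
  refine ⟨bilin_phiB_comb φ, fun c => ?_⟩
  have hy : comb (φ ∘ xv) (φ ∘ av) (φ ∘ yv) (![0, 0, 1] : Fin 3 → S) = φ ∘ yv (k := k) := by
    ext i; simp [comb]
  rw [trilin_phiT_comb, ← hy, trilin_phiT_comb]
  simp

end UniversalFatFlag

/-! ### §2: algebra of fat flags -/

section FatFlagAlgebra

variable {R S : Type*} [CommRing R] [CommRing S]

/-- `comb` under a ring homomorphism. [folklore] -/
theorem map_comb (φ : R →+* S) (u v y : Fin 9 → R) (c : Fin 3 → R) (i : Fin 9) :
    φ (comb u v y c i) = comb (φ ∘ u) (φ ∘ v) (φ ∘ y) (φ ∘ c) i := by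
  simp [comb]

/-- `bilin` under a ring homomorphism. [folklore] -/
theorem map_bilin (φ : R →+* S) (B : Fin 9 → Fin 9 → R) (w w' : Fin 9 → R) :
    φ (bilin B w w') = bilin (fun i j => φ (B i j)) (φ ∘ w) (φ ∘ w') := by
  simp [bilin, map_sum]

/-- `trilin` under a ring homomorphism. [folklore] -/
theorem map_trilin (φ : R →+* S) (T : Fin 9 × Fin 9 × Fin 9 → R) (w : Fin 9 → R) :
    φ (trilin T w) = trilin (fun p => φ (T p)) (φ ∘ w) := by
  simp [trilin, map_sum]

/-- **Fat flags are preserved by ring homomorphisms onto** (every coefficient vector lifts).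
[folklore] -/
theorem IsFatFlag.map {B : Fin 9 → Fin 9 → R} {T : Fin 9 × Fin 9 × Fin 9 → R} {u v y : Fin 9 → R}
    (h : IsFatFlag B T u v y) (φ : R →+* S) (hφ : Function.Surjective φ) :
    IsFatFlag (fun i j => φ (B i j)) (fun p => φ (T p)) (φ ∘ u) (φ ∘ v) (φ ∘ y) := by
  refine ⟨fun c' => ?_, fun c' => ?_⟩
  · obtain ⟨c, rfl⟩ : ∃ c : Fin 3 → R, φ ∘ c = c' := ⟨fun i => (hφ (c' i)).choose,
      funext fun i => (hφ (c' i)).choose_spec⟩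
    have e := congrArg φ (h.1 c)
    rw [map_bilin, map_zero] at e
    have hcomb : (φ ∘ comb u v y c) = comb (φ ∘ u) (φ ∘ v) (φ ∘ y) (φ ∘ c) :=
      funext fun i => map_comb φ u v y c i
    rwa [hcomb] at e
  · obtain ⟨c, rfl⟩ : ∃ c : Fin 3 → R, φ ∘ c = c' := ⟨fun i => (hφ (c' i)).choose,
      funext fun i => (hφ (c' i)).choose_spec⟩
    have e := congrArg φ (h.2 c)
    rw [map_trilin, map_mul, map_pow, map_trilin] at e
    have hcomb : (φ ∘ comb u v y c) = comb (φ ∘ u) (φ ∘ v) (φ ∘ y) (φ ∘ c) :=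
      funext fun i => map_comb φ u v y c i
    rwa [hcomb] at e

/-- **Fat flags descend along injective ring homomorphisms**: if the images form a fat flag, so
do the originals. [folklore] -/
theorem IsFatFlag.of_injective {B : Fin 9 → Fin 9 → R} {T : Fin 9 × Fin 9 × Fin 9 → R} {u v y : Fin 9 → R}
    (φ : R →+* S) (hφ : Function.Injective φ)
    (h : IsFatFlag (fun i j => φ (B i j)) (fun p => φ (T p)) (φ ∘ u) (φ ∘ v) (φ ∘ y)) :
    IsFatFlag B T u v y := by
  refine ⟨fun c => hφ ?_, fun c => hφ ?_⟩
  · rw [map_bilin, map_zero]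
    have hcomb : (φ ∘ comb u v y c) = comb (φ ∘ u) (φ ∘ v) (φ ∘ y) (φ ∘ c) :=
      funext fun i => map_comb φ u v y c i
    rw [hcomb]
    exact h.1 _
  · rw [map_trilin, map_mul, map_pow, map_trilin]
    have hcomb : (φ ∘ comb u v y c) = comb (φ ∘ u) (φ ∘ v) (φ ∘ y) (φ ∘ c) :=
      funext fun i => map_comb φ u v y c i
    rw [hcomb]
    exact h.2 _

/-- **Fat flags are preserved by a change of basis of the flag**: `u', v' ∈ span(u, v)` and
`y' ∈ R y + span(u, v)`. [folklore] -/
theorem IsFatFlag.baseChange {B : Fin 9 → Fin 9 → R} {T : Fin 9 × Fin 9 × Fin 9 → R} {u v y : Fin 9 → R}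
    (h : IsFatFlag B T u v y) (α β γ δ la μ ν : R) :
    IsFatFlag B T (α • u + β • v) (γ • u + δ • v) (la • y + μ • u + ν • v) := by
  have key : ∀ c : Fin 3 → R, comb (α • u + β • v) (γ • u + δ • v) (la • y + μ • u + ν • v) c =
      comb u v y ![c 0 * α + c 1 * γ + c 2 * μ, c 0 * β + c 1 * δ + c 2 * ν, c 2 * la] := by
    intro c; ext i
    simp [comb]
    ring
  have hy : trilin T (la • y + μ • u + ν • v) = la ^ 3 * trilin T y := by
    have e := h.2 ![μ, ν, la]
    have hc : comb u v y (![μ, ν, la] : Fin 3 → R) = la • y + μ • u + ν • v := by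
      ext i; simp [comb]; ring
    rw [hc] at e
    rw [e]; simp
  refine ⟨fun c => ?_, fun c => ?_⟩
  · rw [key]; exact h.1 _
  · rw [key, h.2, hy]
    simp; ring

end FatFlagAlgebra


/-! ### §3: the Plücker pivot over a valuation ring -/

section Pivot

variable {L : Type*} [Field L] (𝒪 : ValuationSubring L)

/-- In a finite family with a non-zero member there is an index of maximal valuation, and all
ratios by it lie in the valuation ring. [folklore] -/
theorem exists_forall_div_mem {ι : Type*} [Fintype ι] (f : ι → L) {i₁ : ι} (h : f i₁ ≠ 0) :
    ∃ i₀ : ι, f i₀ ≠ 0 ∧ ∀ i, f i / f i₀ ∈ 𝒪 := by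
  classical
  obtain ⟨i₀, -, hmax⟩ := Finset.exists_max_image Finset.univ (fun i => 𝒪.valuation (f i)) ⟨i₁, Finset.mem_univ _⟩
  have h0 : f i₀ ≠ 0 := by
    intro hz
    have := hmax i₁ (Finset.mem_univ _)
    rw [hz, map_zero] at this
    exact h ((map_eq_zero 𝒪.valuation).1 (le_antisymm this zero_le))
  refine ⟨i₀, h0, fun i => ?_⟩
  rw [← 𝒪.valuation_le_one_iff, map_div₀]
  exact div_le_one_of_le₀ (hmax i (Finset.mem_univ _)) zero_le

variable {𝒪}
variable {B : Fin 9 → Fin 9 → L} {T : Fin 9 × Fin 9 × Fin 9 → L} {x a y : Fin 9 → L}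

/-- **The pivot.** For a fat flag `(x, a, y)` over the fraction field `L` of a valuation ring `𝒪`
in unitriangular normal form (`x₀ = 1`, `a₀ = 0`, `a₁ = 1`, `y₀ = y₁ = 0`, `y₂ = 1`) with `x ∈ 𝒪⁹`,
there is a fat flag `(u, v, w)` of the SAME line and plane with `u, v, w ∈ 𝒪⁹` in chart normal form
(`u_{i₀} = 1`, `u_{j₀} = 0`, `v_{i₀} = 0`, `v_{j₀} = 1`, `w_{i₀} = w_{j₀} = 0`, `w_{c₀} = 1`) and
`x = x_{i₀} u + x_{j₀} v`: divide the rows `i₀`, `j₀` of the Plücker matrix `x ∧ a` by its entry of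
least valuation, and normalise `y` modulo the line and by its entry of least valuation (the valuative
criterion of properness for the flag variety, in coordinates). [folklore] -/
theorem exists_integral_fatFlag (hx0 : x 0 = 1) (ha0 : a 0 = 0) (ha1 : a 1 = 1)
    (hy0 : y 0 = 0) (hy1 : y 1 = 0) (hy2 : y 2 = 1) (hfat : IsFatFlag B T x a y) :
    ∃ (i₀ j₀ c₀ : Fin 9) (u v w : Fin 9 → L),
      (∀ i, u i ∈ 𝒪) ∧ (∀ i, v i ∈ 𝒪) ∧ (∀ i, w i ∈ 𝒪) ∧
      u i₀ = 1 ∧ u j₀ = 0 ∧ v i₀ = 0 ∧ v j₀ = 1 ∧ w i₀ = 0 ∧ w j₀ = 0 ∧ w c₀ = 1 ∧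
      (∀ i, x i = x i₀ * u i + x j₀ * v i) ∧ IsFatFlag B T u v w := by
  -- the Plücker matrix and its pivot
  set p : Fin 9 × Fin 9 → L := fun ij => x ij.1 * a ij.2 - x ij.2 * a ij.1 with hp
  have hp01 : p (0, 1) = 1 := by simp [hp, hx0, ha0, ha1]
  obtain ⟨⟨i₀, j₀⟩, hπ, hdiv⟩ := exists_forall_div_mem 𝒪 p (i₁ := (0, 1)) (by rw [hp01]; exact one_ne_zero)
  set π := p (i₀, j₀) with hπdef
  have hπ' : x i₀ * a j₀ - x j₀ * a i₀ ≠ 0 := hπ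
  -- the normalised frame of the line
  set u : Fin 9 → L := fun i => p (i, j₀) / π with hu
  set v : Fin 9 → L := fun j => p (i₀, j) / π with hv
  have hu_mem : ∀ i, u i ∈ 𝒪 := fun i => hdiv (i, j₀)
  have hv_mem : ∀ j, v j ∈ 𝒪 := fun j => hdiv (i₀, j)
  have hui : u i₀ = 1 := by simp only [hu]; rw [← hπdef]; exact div_self hπ
  have huj : u j₀ = 0 := by simp [hu, hp]
  have hvi : v i₀ = 0 := by simp [hv, hp]
  have hvj : v j₀ = 1 := by simp only [hv]; rw [← hπdef]; exact div_self hπ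
  have hxuv : ∀ i, x i = x i₀ * u i + x j₀ * v i := by
    intro i
    simp only [hu, hv, hp]
    field_simp
    ring
  -- `u`, `v` as combinations of `x`, `a`
  have hu_eq : u = (a j₀ / π) • x + (-(x j₀) / π) • a := by
    ext i; simp only [hu, hp, Pi.add_apply, Pi.smul_apply, smul_eq_mul]; field_simp; ring
  have hv_eq : v = (-(a i₀) / π) • x + (x i₀ / π) • a := by
    ext i; simp only [hv, hp, Pi.add_apply, Pi.smul_apply, smul_eq_mul]; field_simp; ring
  have hfat_uv : IsFatFlag B T u v y := by
    have h := hfat.baseChange (a j₀ / π) (-(x j₀) / π) (-(a i₀) / π) (x i₀ / π) 1 0 0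
    rw [← hu_eq, ← hv_eq] at h
    simpa using h
  -- normalise `y` modulo the line
  set y' : Fin 9 → L := y - y i₀ • u - y j₀ • v with hy'
  have hy'i : y' i₀ = 0 := by simp [hy', hui, hvi]
  have hy'j : y' j₀ = 0 := by simp [hy', huj, hvj]
  have hy'ne : y' ≠ 0 := by
    intro hz
    -- then `y ∈ span(x, a)`, contradicting the normal form
    have hyi : ∀ i, y i = y i₀ * u i + y j₀ * v i := by
      intro i
      have := congrFun hz i
      simp only [hy', Pi.sub_apply, Pi.smul_apply, smul_eq_mul, Pi.zero_apply] at this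
      linear_combination this
    set A : L := (y i₀ * a j₀ - y j₀ * a i₀) / π with hA
    set B' : L := (-(y i₀) * x j₀ + y j₀ * x i₀) / π with hB'
    have hAB : ∀ i, y i = A * x i + B' * a i := by
      intro i
      rw [hyi i]
      simp only [hu, hv, hp, hA, hB']
      field_simp
      ring
    have e0 := hAB 0
    have e1 := hAB 1
    have e2 := hAB 2
    rw [hy0, hx0, ha0] at e0
    rw [hy1, ha1] at e1
    rw [hy2] at e2
    have hA0 : A = 0 := by linear_combination -e0
    have hB0 : B' = 0 := by linear_combination -e1 - x 1 * hA0
    rw [hA0, hB0] at e2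
    simp at e2
  obtain ⟨c₁, hc₁⟩ : ∃ c, y' c ≠ 0 := Function.ne_iff.mp hy'ne
  obtain ⟨c₀, hc₀, hwdiv⟩ := exists_forall_div_mem 𝒪 y' hc₁
  set w : Fin 9 → L := fun i => y' i / y' c₀ with hw
  refine ⟨i₀, j₀, c₀, u, v, w, hu_mem, hv_mem, hwdiv, hui, huj, hvi, hvj, ?_, ?_, ?_, hxuv, ?_⟩
  · simp [hw, hy'i]
  · simp [hw, hy'j]
  · simp [hw, div_self hc₀]
  · have h := hfat_uv.baseChange 1 0 0 1 (1 / y' c₀) (-(y i₀) / y' c₀) (-(y j₀) / y' c₀)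
    have hw_eq : (1 / y' c₀) • y + (-(y i₀) / y' c₀) • u + (-(y j₀) / y' c₀) • v = w := by
      ext i
      simp only [hw, hy', Pi.add_apply, Pi.sub_apply, Pi.smul_apply, smul_eq_mul]
      field_simp
      ring
    rw [hw_eq] at h
    simpa using h

end Pivot


/-! ### §4: descent to `K` and the covering theorem in coordinates -/

section Descent

/-- **Weak Nullstellensatz, system form**: over an algebraically closed field, a system of
polynomial equations in finitely many variables with a solution in some non-trivial `K`-algebra has
a solution in `K` (the evaluation kills a proper ideal, contained in a maximal ideal, which is the
ideal of a point). [folklore] -/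
theorem exists_eval_eq_zero_of_algHom {K : Type*} [Field K] [IsAlgClosed K] {σ : Type*} [Finite σ]
    {E : Type*} [CommRing E] [Nontrivial E] [Algebra K E] (e : MvPolynomial σ K →ₐ[K] E)
    (S : Set (MvPolynomial σ K)) (hS : ∀ f ∈ S, e f = 0) :
    ∃ z : σ → K, ∀ f ∈ S, MvPolynomial.eval z f = 0 := by
  have hI : Ideal.span S ≤ RingHom.ker (e : MvPolynomial σ K →+* E) := by
    rw [Ideal.span_le]; intro f hf; exact hS f hf
  have hne : Ideal.span S ≠ ⊤ := by
    intro htop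
    have h1 : (1 : MvPolynomial σ K) ∈ RingHom.ker (e : MvPolynomial σ K →+* E) := hI (htop ▸ Submodule.mem_top)
    rw [RingHom.mem_ker, map_one] at h1
    exact one_ne_zero h1
  obtain ⟨𝔫, h𝔫, hle⟩ := Ideal.exists_le_maximal _ hne
  obtain ⟨z, rfl⟩ := (MvPolynomial.isMaximal_iff_eq_vanishingIdeal_singleton (K := K)).1 h𝔫
  refine ⟨z, fun f hf => ?_⟩
  have h := hle (Ideal.subset_span hf)
  rw [MvPolynomial.mem_vanishingIdeal_singleton_iff] at h
  exact h

/-- Three vectors in chart normal form are linearly independent. [folklore] -/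
theorem linearIndependent_of_normalForm {K : Type*} [Field K] {u v w : Fin 9 → K} {i₀ j₀ c₀ : Fin 9}
    (hui : u i₀ = 1) (huj : u j₀ = 0) (hvi : v i₀ = 0) (hvj : v j₀ = 1) (hwi : w i₀ = 0) (hwj : w j₀ = 0)
    (hwc : w c₀ = 1) : LinearIndependent K ![u, v, w] := by
  rw [Fintype.linearIndependent_iff]
  intro g hg i
  have h0 := congrFun hg i₀
  have h1 := congrFun hg j₀
  have h2 := congrFun hg c₀
  simp only [Fin.sum_univ_three, Matrix.cons_val_zero, Matrix.cons_val_one, Matrix.cons_val,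
    Pi.add_apply, Pi.smul_apply, smul_eq_mul, Pi.zero_apply, hui, huj, hvi, hvj, hwi, hwj, hwc] at h0 h1 h2
  have g0 : g 0 = 0 := by linear_combination h0
  have g1 : g 1 = 0 := by linear_combination h1
  have g2 : g 2 = 0 := by linear_combination h2 - u c₀ * g0 - v c₀ * g1
  fin_cases i <;> assumption

end Descent

section Covering

variable {K : Type*} [Field K] [IsAlgClosed K] [CharZero K]

/-- The point `x_t = (1, x'(t)) ∈ K⁹` of a `K`-point `t` of `N`. [folklore] -/
def xt (t : NVar → K) : Fin 9 → K := fun i => MvPolynomial.eval t (xN i)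

/-- **The covering theorem in coordinates** (Hirschowitz–Iyer, Prop. 6.1 for
`(n, r, s, d) = (8, 1, 2, (2, 3))`, at a point with `x₀ ≠ 0`): for an algebraically closed field `K` of
characteristic zero, forms `B` (bilinear) and `T` (trilinear) on `K⁹` and a point `x = (1, x')` with
`Q_B(x) = C_T(x) = 0`, there is a fat flag `(u, v, w)` — a `3`-fat line `span(u, v) ∋ x` of
`V(Q_B, C_T)` in the plane `span(u, v, w) ⊆ V(Q_B)` — i.e. a STRONG LINE of the pair
`V(Q_B, C_T) ⊂ V(Q_B)` through `x`. Proof: the generic point of the universal family specialises to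
`(B, T, x)` along a valuation ring (`ker Φ* = (Q_B(x), C_T(x))`, `ker_phiStar_eq`), the universal fat
flag is put in integral normal form by the Plücker pivot and reduced, and the reduced flag descends
from the residue field to `K` by the Nullstellensatz.
[cite: HirschowitzIyer2010, §6 Prop. 6.1 and Prop. 6.2] -/
theorem exists_fatFlag_of_incidence (t : NVar → K) (hQ : MvPolynomial.eval t QBx = 0)
    (hC : MvPolynomial.eval t CTx = 0) :
    ∃ u v w : Fin 9 → K, LinearIndependent K ![u, v, w] ∧
      (∃ α β : K, xt t = α • u + β • v) ∧
      IsFatFlag (fun i j => t (.b (i, j))) (fun p => t (.t p)) u v w := by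
  classical
  -- Step 1: the maximal ideal of `t` contains `ker Φ*`
  set 𝔪 : Ideal (RN K) := MvPolynomial.vanishingIdeal K {t} with h𝔪
  haveI h𝔪max : 𝔪.IsMaximal := inferInstance
  have hker : RingHom.ker (phiStar K) ≤ 𝔪 := by
    rw [ker_phiStar_eq, incidenceIdeal, Ideal.span_le]
    rintro f (rfl | rfl)
    · show QBx ∈ 𝔪
      rw [h𝔪, MvPolynomial.mem_vanishingIdeal_singleton_iff]; exact hQ
    · show CTx ∈ 𝔪
      rw [h𝔪, MvPolynomial.mem_vanishingIdeal_singleton_iff]; exact hC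
  -- Step 2: the generic point of `𝔸⁸¹⁶` and the local ring at `t`
  let L := FractionRing (RZ K)
  let χ : RZ K →+* L := algebraMap (RZ K) L
  have hχ : Function.Injective χ := IsFractionRing.injective (RZ K) L
  let gmap : RN K →+* L := χ.comp (phiStar K : RN K →+* RZ K)
  let RL := Localization.AtPrime 𝔪
  have hunit : ∀ s : 𝔪.primeCompl, IsUnit (gmap s) := by
    intro s
    rw [isUnit_iff_ne_zero]
    intro h0
    have h1 : phiStar K (s : RN K) = 0 := hχ (by rw [map_zero]; exact h0)
    exact s.2 (hker h1)
  let f : RL →+* L := IsLocalization.lift hunit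
  have hf : ∀ r : RN K, f (algebraMap (RN K) RL r) = χ (phiStar K r) := fun r => IsLocalization.lift_eq hunit r
  -- Step 3: a valuation ring of `L` dominating the local ring at `t`
  obtain ⟨𝒪, hmem, hloc⟩ := IsLocalRing.exists_factor_valuationRing f
  let f' : RL →+* 𝒪.toSubring := f.codRestrict 𝒪.toSubring hmem
  haveI : IsLocalHom f' := hloc
  haveI : IsLocalRing 𝒪.toSubring := inferInstanceAs (IsLocalRing 𝒪)
  let kO := IsLocalRing.ResidueField 𝒪.toSubring
  let res : 𝒪.toSubring →+* kO := IsLocalRing.residue 𝒪.toSubring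
  let ρ : RN K →+* kO := res.comp (f'.comp (algebraMap (RN K) RL))
  have hρ𝔪 : ∀ m ∈ 𝔪, ρ m = 0 := by
    intro m hm
    have h1 : algebraMap (RN K) RL m ∈ IsLocalRing.maximalIdeal RL :=
      (IsLocalization.AtPrime.to_map_mem_maximal_iff RL 𝔪 m).2 hm
    have h2 : f' (algebraMap (RN K) RL m) ∈ IsLocalRing.maximalIdeal 𝒪.toSubring := by
      rw [IsLocalRing.mem_maximalIdeal] at h1 ⊢
      exact fun hu => h1 (IsUnit.of_map f' _ hu)
    change res (f' (algebraMap (RN K) RL m)) = 0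
    rwa [IsLocalRing.residue_eq_zero_iff]
  let ι : K →+* kO := ρ.comp MvPolynomial.C
  have hρ : ∀ F : RN K, ρ F = ι (MvPolynomial.eval t F) := by
    intro F
    have hmem𝔪 : F - C (MvPolynomial.eval t F) ∈ 𝔪 := by
      rw [h𝔪, MvPolynomial.mem_vanishingIdeal_singleton_iff]
      change MvPolynomial.eval t (F - C (MvPolynomial.eval t F)) = 0
      simp
    have h := hρ𝔪 _ hmem𝔪
    rw [map_sub, sub_eq_zero] at h
    exact h
  -- Step 4: the `𝒪`-valued coordinates of the generic point and their reductions
  have hval : ∀ r : RN K, ((f' (algebraMap (RN K) RL r) : 𝒪.toSubring) : L) = χ (phiStar K r) := fun r => hf r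
  have hres : ∀ r : RN K, res (f' (algebraMap (RN K) RL r)) = ι (MvPolynomial.eval t r) := fun r => hρ r
  let BO : Fin 9 → Fin 9 → 𝒪.toSubring := fun i j => f' (algebraMap (RN K) RL (X (.b (i, j))))
  let TO : Fin 9 × Fin 9 × Fin 9 → 𝒪.toSubring := fun p => f' (algebraMap (RN K) RL (X (.t p)))
  let xO : Fin 9 → 𝒪.toSubring := fun i => f' (algebraMap (RN K) RL (xN i))
  have hBO : ∀ i j, ((BO i j : 𝒪.toSubring) : L) = χ (phiBmat i j) := fun i j => by
    rw [hval, phiStar_X]; rfl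
  have hTO : ∀ p, ((TO p : 𝒪.toSubring) : L) = χ (phiT p) := fun p => by
    rw [hval, phiStar_X]; rfl
  have hxO : ∀ i, ((xO i : 𝒪.toSubring) : L) = χ (xv i) := fun i => by
    rw [hval, phiStar_xN]
  -- Step 5: the universal fat flag over `L`, in normal form
  have hfatL : IsFatFlag (fun i j => χ (phiBmat (k := K) i j)) (fun p => χ (phiT p)) (χ ∘ xv) (χ ∘ av) (χ ∘ yv) :=
    isFatFlag_universal χ
  have hx0 : (χ ∘ xv (k := K)) 0 = 1 := by simp [xv]
  have ha0 : (χ ∘ av (k := K)) 0 = 0 := by simp [av]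
  have ha1 : (χ ∘ av (k := K)) 1 = 1 := by simp [av]
  have hy0 : (χ ∘ yv (k := K)) 0 = 0 := by simp [yv]
  have hy1 : (χ ∘ yv (k := K)) 1 = 0 := by simp [yv]
  have hy2 : (χ ∘ yv (k := K)) 2 = 1 := by simp [yv]
  -- Step 6: the pivot
  obtain ⟨i₀, j₀, c₀, u, v, w, hu, hv, hw, hui, huj, hvi, hvj, hwi, hwj, hwc, hxuv, hfatuvw⟩ :=
    exists_integral_fatFlag (𝒪 := 𝒪) hx0 ha0 ha1 hy0 hy1 hy2 hfatL
  -- Step 7: lift to `𝒪`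
  let uO : Fin 9 → 𝒪.toSubring := fun i => ⟨u i, hu i⟩
  let vO : Fin 9 → 𝒪.toSubring := fun i => ⟨v i, hv i⟩
  let wO : Fin 9 → 𝒪.toSubring := fun i => ⟨w i, hw i⟩
  have hfatO : IsFatFlag BO TO uO vO wO := by
    refine IsFatFlag.of_injective (𝒪.toSubring.subtype) Subtype.val_injective ?_
    have e1 : (fun i j => 𝒪.toSubring.subtype (BO i j)) = fun i j => χ (phiBmat (k := K) i j) := by
      funext i j; exact hBO i j
    have e2 : (fun p => 𝒪.toSubring.subtype (TO p)) = fun p => χ (phiT (k := K) p) := by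
      funext p; exact hTO p
    rw [e1, e2]
    exact hfatuvw
  have hxOrel : ∀ i, xO i = xO i₀ * uO i + xO j₀ * vO i := by
    intro i
    apply Subtype.ext
    change ((xO i : 𝒪.toSubring) : L) = (xO i₀ : L) * u i + (xO j₀ : L) * v i
    rw [hxO, hxO, hxO]
    exact hxuv i
  -- Step 8: reduce modulo the maximal ideal of `𝒪`
  have hres_surj : Function.Surjective res := Ideal.Quotient.mk_surjective
  have hfatk : IsFatFlag (fun i j => res (BO i j)) (fun p => res (TO p)) (res ∘ uO) (res ∘ vO) (res ∘ wO) :=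
    hfatO.map res hres_surj
  have hBk : (fun i j => res (BO i j)) = fun i j => ι (t (.b (i, j))) := by
    funext i j; rw [hres]; simp
  have hTk : (fun p => res (TO p)) = fun p => ι (t (.t p)) := by
    funext p; rw [hres]; simp
  rw [hBk, hTk] at hfatk
  have hxk : ∀ i, ι (xt t i) = ι (xt t i₀) * (res ∘ uO) i + ι (xt t j₀) * (res ∘ vO) i := by
    intro i
    have h := congrArg res (hxOrel i)
    rw [map_add, map_mul, map_mul, hres, hres, hres] at h
    exact h
  have hnui : (res ∘ uO) i₀ = 1 := by
    change res ⟨u i₀, hu i₀⟩ = 1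
    rw [show (⟨u i₀, hu i₀⟩ : 𝒪.toSubring) = 1 from Subtype.ext hui, map_one]
  have hnuj : (res ∘ uO) j₀ = 0 := by
    change res ⟨u j₀, hu j₀⟩ = 0
    rw [show (⟨u j₀, hu j₀⟩ : 𝒪.toSubring) = 0 from Subtype.ext huj, map_zero]
  have hnvi : (res ∘ vO) i₀ = 0 := by
    change res ⟨v i₀, hv i₀⟩ = 0
    rw [show (⟨v i₀, hv i₀⟩ : 𝒪.toSubring) = 0 from Subtype.ext hvi, map_zero]
  have hnvj : (res ∘ vO) j₀ = 1 := by
    change res ⟨v j₀, hv j₀⟩ = 1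
    rw [show (⟨v j₀, hv j₀⟩ : 𝒪.toSubring) = 1 from Subtype.ext hvj, map_one]
  have hnwi : (res ∘ wO) i₀ = 0 := by
    change res ⟨w i₀, hw i₀⟩ = 0
    rw [show (⟨w i₀, hw i₀⟩ : 𝒪.toSubring) = 0 from Subtype.ext hwi, map_zero]
  have hnwj : (res ∘ wO) j₀ = 0 := by
    change res ⟨w j₀, hw j₀⟩ = 0
    rw [show (⟨w j₀, hw j₀⟩ : 𝒪.toSubring) = 0 from Subtype.ext hwj, map_zero]
  have hnwc : (res ∘ wO) c₀ = 1 := by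
    change res ⟨w c₀, hw c₀⟩ = 1
    rw [show (⟨w c₀, hw c₀⟩ : 𝒪.toSubring) = 1 from Subtype.ext hwc, map_one]
  -- Step 9: the polynomial system and its solution over `kO`
  letI : Algebra K kO := ι.toAlgebra
  let sol : Fin 3 × Fin 9 → kO := fun si => (![res ∘ uO, res ∘ vO, res ∘ wO] : Fin 3 → Fin 9 → kO) si.1 si.2
  let e : MvPolynomial (Fin 3 × Fin 9) K →ₐ[K] kO := MvPolynomial.aeval sol
  let Xu : Fin 9 → MvPolynomial (Fin 3 × Fin 9) K := fun i => X (0, i)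
  let Xv : Fin 9 → MvPolynomial (Fin 3 × Fin 9) K := fun i => X (1, i)
  let Xw : Fin 9 → MvPolynomial (Fin 3 × Fin 9) K := fun i => X (2, i)
  let Bt : Fin 9 → Fin 9 → K := fun i j => t (.b (i, j))
  let Tt : Fin 9 × Fin 9 × Fin 9 → K := fun p => t (.t p)
  let S : Set (MvPolynomial (Fin 3 × Fin 9) K) :=
    {Xu i₀ - 1, Xu j₀, Xv i₀, Xv j₀ - 1, Xw i₀, Xw j₀, Xw c₀ - 1} ∪
    Set.range (fun i : Fin 9 => C (xt t i) - C (xt t i₀) * Xu i - C (xt t j₀) * Xv i) ∪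
    Set.range (fun c : Fin 3 → K => bilin (fun i j => C (Bt i j)) (comb Xu Xv Xw (C ∘ c)) (comb Xu Xv Xw (C ∘ c))) ∪
    Set.range (fun c : Fin 3 → K => trilin (fun p => C (Tt p)) (comb Xu Xv Xw (C ∘ c)) -
      C (c 2) ^ 3 * trilin (fun p => C (Tt p)) Xw)
  have heC : ∀ a : K, e (C a) = ι a := fun a => by
    rw [MvPolynomial.algHom_C]; rfl
  have heu : (e : MvPolynomial (Fin 3 × Fin 9) K →+* kO) ∘ Xu = res ∘ uO := by
    funext i; simp [e, Xu, sol]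
  have hev : (e : MvPolynomial (Fin 3 × Fin 9) K →+* kO) ∘ Xv = res ∘ vO := by
    funext i; simp [e, Xv, sol]
  have hew : (e : MvPolynomial (Fin 3 × Fin 9) K →+* kO) ∘ Xw = res ∘ wO := by
    funext i; simp [e, Xw, sol]
  have hecomb : ∀ c : Fin 3 → K, (e : MvPolynomial (Fin 3 × Fin 9) K →+* kO) ∘ comb Xu Xv Xw (C ∘ c) =
      comb (res ∘ uO) (res ∘ vO) (res ∘ wO) (ι ∘ c) := by
    intro c
    funext i
    rw [Function.comp_apply, map_comb, heu, hev, hew]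
    congr 1
    funext j; exact heC (c j)
  have hS : ∀ F ∈ S, e F = 0 := by
    intro F hF
    simp only [S, Set.mem_union, Set.mem_insert_iff, Set.mem_singleton_iff, Set.mem_range] at hF
    rcases hF with ((hF | ⟨i, rfl⟩) | ⟨c, rfl⟩) | ⟨c, rfl⟩
    · rcases hF with rfl | rfl | rfl | rfl | rfl | rfl | rfl
      · rw [map_sub, map_one]; change e (Xu i₀) - 1 = 0
        rw [show e (Xu i₀) = (res ∘ uO) i₀ from congrFun heu i₀, hnui, sub_self]
      · rw [show e (Xu j₀) = (res ∘ uO) j₀ from congrFun heu j₀, hnuj]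
      · rw [show e (Xv i₀) = (res ∘ vO) i₀ from congrFun hev i₀, hnvi]
      · rw [map_sub, map_one]; change e (Xv j₀) - 1 = 0
        rw [show e (Xv j₀) = (res ∘ vO) j₀ from congrFun hev j₀, hnvj, sub_self]
      · rw [show e (Xw i₀) = (res ∘ wO) i₀ from congrFun hew i₀, hnwi]
      · rw [show e (Xw j₀) = (res ∘ wO) j₀ from congrFun hew j₀, hnwj]
      · rw [map_sub, map_one]; change e (Xw c₀) - 1 = 0
        rw [show e (Xw c₀) = (res ∘ wO) c₀ from congrFun hew c₀, hnwc, sub_self]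
    · rw [map_sub, map_sub, map_mul, map_mul, heC, heC, heC,
        show e (Xu i) = (res ∘ uO) i from congrFun heu i, show e (Xv i) = (res ∘ vO) i from congrFun hev i,
        hxk i]
      ring
    · change (e : MvPolynomial (Fin 3 × Fin 9) K →+* kO) (bilin _ _ _) = 0
      rw [map_bilin, hecomb]
      have hBe : (fun i j => (e : MvPolynomial (Fin 3 × Fin 9) K →+* kO) (C (Bt i j))) = fun i j => ι (t (.b (i, j))) := by
        funext i j; exact heC _
      rw [hBe]
      exact hfatk.1 _
    · change (e : MvPolynomial (Fin 3 × Fin 9) K →+* kO) (trilin _ _ - C (c 2) ^ 3 * trilin _ _) = 0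
      rw [map_sub, map_mul, map_pow, map_trilin, map_trilin, hecomb, hew]
      have hTe : (fun p => (e : MvPolynomial (Fin 3 × Fin 9) K →+* kO) (C (Tt p))) = fun p => ι (t (.t p)) := by
        funext p; exact heC _
      rw [hTe, hfatk.2, sub_eq_zero]
      congr 1
      rw [show ((e : MvPolynomial (Fin 3 × Fin 9) K →+* kO) (C (c 2))) = ι (c 2) from heC _]
      rfl
  -- Step 10: descend to `K`
  obtain ⟨z, hz⟩ := exists_eval_eq_zero_of_algHom e S hS
  let u' : Fin 9 → K := fun i => z (0, i)
  let v' : Fin 9 → K := fun i => z (1, i)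
  let w' : Fin 9 → K := fun i => z (2, i)
  have hzS : ∀ F, F ∈ S → MvPolynomial.eval z F = 0 := hz
  have mem1 : ∀ F, F ∈ ({Xu i₀ - 1, Xu j₀, Xv i₀, Xv j₀ - 1, Xw i₀, Xw j₀, Xw c₀ - 1} : Set _) → F ∈ S :=
    fun F hF => Or.inl (Or.inl (Or.inl hF))
  have hn1 : u' i₀ = 1 := by
    have h := hzS _ (mem1 (Xu i₀ - 1) (by simp)); simp [Xu] at h; linear_combination h
  have hn2 : u' j₀ = 0 := by
    have h := hzS _ (mem1 (Xu j₀) (by simp)); simpa [Xu] using h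
  have hn3 : v' i₀ = 0 := by
    have h := hzS _ (mem1 (Xv i₀) (by simp)); simpa [Xv] using h
  have hn4 : v' j₀ = 1 := by
    have h := hzS _ (mem1 (Xv j₀ - 1) (by simp)); simp [Xv] at h; linear_combination h
  have hn5 : w' i₀ = 0 := by
    have h := hzS _ (mem1 (Xw i₀) (by simp)); simpa [Xw] using h
  have hn6 : w' j₀ = 0 := by
    have h := hzS _ (mem1 (Xw j₀) (by simp)); simpa [Xw] using h
  have hn7 : w' c₀ = 1 := by
    have h := hzS _ (mem1 (Xw c₀ - 1) (by simp)); simp [Xw] at h; linear_combination h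
  have hzu : (MvPolynomial.eval z : MvPolynomial (Fin 3 × Fin 9) K →+* K) ∘ Xu = u' := by funext i; simp [Xu, u']
  have hzv : (MvPolynomial.eval z : MvPolynomial (Fin 3 × Fin 9) K →+* K) ∘ Xv = v' := by funext i; simp [Xv, v']
  have hzw : (MvPolynomial.eval z : MvPolynomial (Fin 3 × Fin 9) K →+* K) ∘ Xw = w' := by funext i; simp [Xw, w']
  have hzcomb : ∀ c : Fin 3 → K, (MvPolynomial.eval z : MvPolynomial (Fin 3 × Fin 9) K →+* K) ∘ comb Xu Xv Xw (C ∘ c) =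
      comb u' v' w' c := by
    intro c; funext i
    rw [Function.comp_apply, map_comb, hzu, hzv, hzw]
    congr 1
    funext j; simp
  refine ⟨u', v', w', linearIndependent_of_normalForm hn1 hn2 hn3 hn4 hn5 hn6 hn7, ⟨xt t i₀, xt t j₀, ?_⟩, ?_, ?_⟩
  · funext i
    have h := hzS _ (Or.inl (Or.inl (Or.inr ⟨i, rfl⟩)))
    simp [Xu, Xv] at h
    simp only [Pi.add_apply, Pi.smul_apply, smul_eq_mul]
    linear_combination h
  · intro c
    have h := hzS _ (Or.inl (Or.inr ⟨c, rfl⟩))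
    change (MvPolynomial.eval z : MvPolynomial (Fin 3 × Fin 9) K →+* K) (bilin _ _ _) = 0 at h
    rw [map_bilin, hzcomb] at h
    simpa using h
  · intro c
    have h := hzS _ (Or.inr ⟨c, rfl⟩)
    change (MvPolynomial.eval z : MvPolynomial (Fin 3 × Fin 9) K →+* K) (trilin _ _ - C (c 2) ^ 3 * trilin _ _) = 0 at h
    rw [map_sub, map_mul, map_pow, map_trilin, map_trilin, hzcomb, hzw, sub_eq_zero] at h
    simpa using h

end Covering

end StrongLineCover

end Literature.AlgebraicGeometry.Motives

end
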